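import Summits.QuantumFields.Balaban3D.Carriers.Series

/-!
# Runbook sanity module — carriers of the `pub-balaban3d` end theorem (review-runbook §2 cards, ops-runbook seat)

Non-vacuity / computed-value witnesses for definition cards of `REVIEW-RUNBOOK.md` (client `pub-balaban3d`, headline
`UVStability3DInputs.uvStability3D_of_inputs`): the numerical data `Scales L` of one lattice approximation (card «Scales»), the
expansion-data record `StepSeries` (card «StepSeries»), the torus step relation `TStepIn` (card «TStepIn») and the interaction sum
`pintOfSeries` (card «pintOfSeries»).  [folklore] arithmetic and bookkeeping only; nothing of CMP 102 is asserted.  For every odd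
`L > 1` an inhabitant of `Scales L` with `1 ≤ K` and arbitrarily small bare coupling is `Proofs.NegativeEdge.scales_fine`.
-/

namespace Summit.QuantumFields.Balaban3D.Runbook

open MeasureTheory
open Literature.MathematicalPhysics.QuantumFieldTheory.Balaban1983to89
open Literature.MathematicalPhysics.QuantumFieldTheory.Balaban1983to89.TreeLengthTorus
open Literature.MathematicalPhysics.QuantumFieldTheory.Balaban1985CMP102
open Literature.MathematicalPhysics.QuantumFieldTheory.Balaban1985CMP102.Setting
open Summit.QuantumFields.Balaban3D.Carriers

/-! ## `Scales` — the structure quantified over is inhabited -/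

/-- An explicit lattice approximation with block size `L = 3`: volume exponent `m = 0`, `K = 0` renormalization steps, spacing
`ε = 1`, `ε₀ = 1` (so `L^K ε = ε₀`), coupling `g = 1` (so `g² ε₀ ≤ 1`).  Non-vacuity of the class `Scales 3` the end theorem's
families range over. [folklore] -/
noncomputable def scalesWitness : Scales 3 where
  hL := ⟨by decide, by norm_num⟩
  m := 0
  K := 0
  ε := 1
  ε_pos := one_pos
  ε₀ := 1
  hK := by norm_num
  g := 1
  g_pos := one_pos
  gK_le_one := by norm_num

/-- `Scales 3` is non-empty. [folklore] -/
instance scales_nonempty : Nonempty (Scales 3) := ⟨scalesWitness⟩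

/-- A finer explicit approximation: `L = 3`, one step (`K = 1`), `ε = 1/3`, `ε₀ = 1`, `g = 1` — the terminal relation `3¹ · (1/3) = 1`
holds and `g² ε₀ = 1 ≤ 1`. [folklore] -/
noncomputable def scalesWitnessOneStep : Scales 3 where
  hL := ⟨by decide, by norm_num⟩
  m := 0
  K := 1
  ε := 1 / 3
  ε_pos := by norm_num
  ε₀ := 1
  hK := by norm_num
  g := 1
  g_pos := one_pos
  gK_le_one := by norm_num

/-- The one-step witness has `K = 1`. [folklore] -/
theorem scalesWitnessOneStep_K : scalesWitnessOneStep.K = 1 := rfl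

/-- The constraint `g² ε₀ ≤ 1` of `Scales` is NOT vacuous: the data `g = 2`, `ε₀ = 1` violate it (so not every tuple of numbers is a
lattice approximation in the cell's normalisation). [folklore] -/
theorem scales_constraint_fails_example : ¬ ((2 : ℝ) ^ 2 * 1 ≤ 1) := by norm_num

/-! ## `StepSeries` — the expansion-data record carries NO proposition field: any data inhabits it -/

section StepSeriesWitness

variable {L : ℕ} (S : Scales L) (G : Type) [GaugeGroup G] [MeasurableSpace G] [HaarData G]
  (V : Type) [NormedAddCommGroup V] [NormedSpace ℂ V] (N : ℕ) [NeZero N] (k : ℕ)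

/-- THE ZERO EXPANSION DATA: every chart, background configuration, far term, polymer sum and previous-scale term `0`, no graph
terms (empty label type), the fluctuation space `ℝ` with the ZERO measure and empty small-field box, zero effective potential, no
Gaussian variables.  It inhabits `StepSeries S G V N k` for EVERY lattice approximation, group, chart space, block number and step:
the record has no `Prop`-valued field, so its non-vacuity is trivial — the content of print's (α) displays enters the end theorem as
HYPOTHESES about a series, never as fields of this record (lane ruling R-DISP). [folklore] -/
noncomputable def zeroStepSeries : StepSeries S G V N k where
  Ψ := fun _ _ => 0
  Bcfg := fun _ _ _ _ => 0
  far := fun _ _ _ => 0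
  PY := fun _ _ => 0
  PYZ := fun _ _ => 0
  Gt := fun _ =>
    { Γ := PEmpty
      supp := ∅
      E := fun γ => nomatch γ
      loc := fun γ => nomatch γ
      nv := fun γ => nomatch γ
      pref := fun γ => nomatch γ
      lines := fun γ => nomatch γ }
  Ndeg := fun _ => 0
  oldVal := fun _ _ _ _ _ _ => 0
  Fl := ℝ
  μ := 0
  box := fun _ => ∅
  𝒱 := fun _ _ _ => 0
  dimZ := fun _ => 0
  QU := fun _ _ => 0
  JU := fun _ _ => 0
  Q1 := fun _ => 0
  J1 := fun _ => 0
  dimT := 0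
  QT := 0
  JT := 0

/-- `StepSeries S G V N k` is non-empty for every choice of its parameters. [folklore] -/
instance stepSeries_nonempty : Nonempty (StepSeries S G V N k) := ⟨zeroStepSeries S G V N k⟩

/-- Computed value: the zero data's polymer sum `PY` vanishes identically. [folklore] -/
theorem zeroStepSeries_PY (h : Hist S.P (k + 1)) (U : GaugeField S.P (k + 1) G) :
    (zeroStepSeries S G V N k).PY h U = 0 := rfl

end StepSeriesWitness

/-! ## `TStepIn` — one instance where the step relation holds, one where it fails -/

/-- On the one-dimensional torus `ℤ/3`: the cubes `0` and `1` are wall-adjacent (`1 = 0 + e₀`), both lie in the family `{0, 1}`, so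
`TStepIn {0, 1} 0 1` HOLDS. [folklore] -/
theorem tStepIn_holds_example :
    TStepIn (d := 1) (N := 3) {fun _ => 0, fun _ => 1} (fun _ => 0) (fun _ => 1) := by
  refine ⟨by simp, by simp, ⟨0, Or.inl ?_⟩⟩
  funext i
  fin_cases i
  simp [Function.update]

/-- The step relation FAILS outside the family: no step inside the empty family of cubes. [folklore] -/
theorem tStepIn_fails_example (a b : TPt 1 3) : ¬ TStepIn (∅ : Finset (TPt 1 3)) a b := by
  rintro ⟨ha, -, -⟩
  simp at ha

/-- The step relation also FAILS for non-adjacent cubes inside the family: on `ℤ/5`, `0` and `2` share no wall. [folklore] -/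
theorem tStepIn_fails_nonadjacent :
    ¬ TStepIn (d := 1) (N := 5) Finset.univ (fun _ => 0) (fun _ => 2) := by
  rintro ⟨-, -, ⟨i, h | h⟩⟩
  · have := congrFun h i
    simp [Function.update] at this
    exact absurd this (by decide)
  · have := congrFun h i
    simp [Function.update] at this
    exact absurd this (by decide)

/-! ## `pintOfSeries` — computed values of the (43) interaction sum -/

section PintValues

variable {L : ℕ} {S : Scales L} {G : Type} [GaugeGroup G] [MeasurableSpace G] [HaarData G]
  {V : Type} [NormedAddCommGroup V] [NormedSpace ℂ V] {Nc : ℕ → ℕ} [∀ k, NeZero (Nc k)]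

/-- Computed value at level `0`: NO interaction in `ρ₀` — `Pint 0 = 0` ((1) p. 256; LQB's `NoInteraction0`). [folklore] -/
theorem pintOfSeries_zero (M₁ : ℕ) (Rcol : ℕ → ℕ) (𝔖 : ∀ k, StepSeries S G V (Nc k) k)
    (h : Hist S.P 0) (U : GaugeField S.P 0 G) : pintOfSeries M₁ Rcol 𝔖 0 h U = 0 := rfl

/-- Computed value at level `k + 1`: the step recursion of (43) p. 266 — kept old terms + new polymer sums (LQB's `PintSucc`). [folklore] -/
theorem pintOfSeries_succ (M₁ : ℕ) (Rcol : ℕ → ℕ) (𝔖 : ∀ k, StepSeries S G V (Nc k) k) (k : ℕ)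
    (h : Hist S.P (k + 1)) (U : GaugeField S.P (k + 1) G) :
    pintOfSeries M₁ Rcol 𝔖 (k + 1) h U = (𝔖 k).PoldIn M₁ Rcol h U + (𝔖 k).PY h U + (𝔖 k).PYZ h U := rfl

/-- With the ZERO expansion data at every step the interaction sum vanishes at every level (the «log run» has no interaction). [folklore] -/
theorem pintOfSeries_zeroStepSeries (M₁ : ℕ) (Rcol : ℕ → ℕ) :
    ∀ (k : ℕ) (h : Hist S.P k) (U : GaugeField S.P k G),
      pintOfSeries M₁ Rcol (fun k => zeroStepSeries S G V (Nc k) k) k h U = 0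
  | 0, _, _ => rfl
  | k + 1, h, U => by
    rw [pintOfSeries_succ]
    simp [zeroStepSeries, StepSeries.PoldIn, oldSumIn]

end PintValues

end Summit.QuantumFields.Balaban3D.Runbook
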